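import Mathlib
import Summits.Ventures.PercRepro2.TB14CutCase2

/-!
# Typed BHK 1.4 across a cut vertex, IV: the root-separating cut vertex with the marks allowed AT the cut
(blind cell PercRepro2, mine-c g15, 2026-08-25; `conjectures/MINE-C.md` §24, `proofs/MINEC-TB14BLOCK.md` Theorem C)

The theorems of `TB14CutCase1` / `TB14CutCase2` restated with every vertex hypothesis on the CLOSED
sides `VA ∪ {c}`, `VB ∪ {c}`: the cut vertex may itself be a root or a mark (`iQ_eq_cut'`,
`iL_cross'`, `iH_cross'` absorb the degenerate cases through `1[c ∈ C(c)] = 1`).  The proofs are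
those of the landed files verbatim; the statements are the ones the block induction needs
(`tb14_of_cut'`).  Own work; standard axioms.
-/

namespace Summit.Ventures.PercRepro2

namespace TB14Cut

open CovForm A3InactiveTyped CutV

section Degenerate

variable {V : Type*} {E : Type*} {ends : E → Sym2 V} {c : V} {VA VB : Set V} {EA EB : Set E}
  [DecidablePred (· ∈ EA)] [DecidablePred (· ∈ EB)] {R : Type*} [Field R]

omit [DecidablePred (· ∈ EA)] [DecidablePred (· ∈ EB)] in
/-- `1[a ∈ C(a)] = 1`. -/
lemma iL_self (ends : E → Sym2 V) (a : V) (u : Config E) : (iL ends a a u : R) = 1 := by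
  classical
  rw [iL_eq_ite', if_pos (conn_refl ends u a)]

omit [DecidablePred (· ∈ EA)] [DecidablePred (· ∈ EB)] in
/-- The separation through the cut vertex, closed sides: `1_Q = 1 − 1[c ∈ C(a₁)] · 1[c ∈ C(a₂)]`
for `a₁ ∈ VA ∪ {c}`, `a₂ ∈ VB ∪ {c}`. -/
lemma iQ_eq_cut' (h : IsCut ends c VA VB EA EB) {a₁ a₂ : V} (ha₁ : a₁ ∈ VA ∪ {c})
    (ha₂ : a₂ ∈ VB ∪ {c}) (u : Config E) :
    (iQ ends a₁ a₂ u : R) = 1 - iL ends a₁ c u * iH ends a₂ c u := by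
  rcases ha₁ with ha₁ | ha₁ <;> rcases ha₂ with ha₂ | ha₂
  · exact iQ_eq_cut h ha₁ ha₂ u
  · rw [Set.mem_singleton_iff] at ha₂
    subst ha₂
    rw [iQ_eq_one_sub_iL, iH_eq_iL, iL_self, mul_one]
  · rw [Set.mem_singleton_iff] at ha₁
    subst ha₁
    rw [iQ_eq_one_sub_iH, iL_self, one_mul]
  · rw [Set.mem_singleton_iff] at ha₁ ha₂
    subst ha₁
    subst ha₂
    rw [iQ_eq_one_sub_iL, iL_self, iH_eq_iL, iL_self, mul_one]

/-- Mark events through the cut, closed sides: for `a ∈ VA ∪ {c}`, `v ∈ VB ∪ {c}`,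
`1[v ∈ C(a)] = 1[c ∈ C(a)] · 1[v ∈ C(c)]`. -/
lemma iL_cross' (h : IsCut ends c VA VB EA EB) {a v : V} (ha : a ∈ VA ∪ {c})
    (hv : v ∈ VB ∪ {c}) (y : Config E) : (iL ends a v y : R) = iL ends a c y * iL ends c v y := by
  rcases ha with ha | ha <;> rcases hv with hv | hv
  · exact iL_cross h ha hv y
  · rw [Set.mem_singleton_iff] at hv
    subst hv
    rw [iL_self, mul_one]
  · rw [Set.mem_singleton_iff] at ha
    subst ha
    rw [iL_self, one_mul]
  · rw [Set.mem_singleton_iff] at ha hv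
    subst ha
    subst hv
    rw [iL_self, mul_one]

/-- The same for the root `a ∈ VB ∪ {c}` and `v ∈ VA ∪ {c}` (`iH` vocabulary). -/
lemma iH_cross' (h : IsCut ends c VA VB EA EB) {a v : V} (ha : a ∈ VB ∪ {c})
    (hv : v ∈ VA ∪ {c}) (y : Config E) : (iH ends a v y : R) = iH ends a c y * iH ends c v y :=
  iL_cross' h.symm ha hv y

end Degenerate

section Main

variable {V : Type} {E : Type} [Fintype E] [DecidableEq E] {ends : E → Sym2 V} {c : V}
  {VA VB : Set V} {EA EB : Set E} [DecidablePred (· ∈ EA)] [DecidablePred (· ∈ EB)]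
  {R : Type*} [Field R] [LinearOrder R] [IsStrictOrderedRing R]

/-- **The (TB14) slack factorises across a cut vertex separating the marks**: for `a₁, b ∈ VA`
and `a₂, o ∈ VB`,
`N(Q∩B, Q∩A) − N(Q∩A∩B, Q) = (N_A(b, c') − N_A(b, c)) · (N_B(c, o') − N_B(c, o))`
(each factor a cross-minus-same count of two cluster events of one root at its side profile). -/
theorem tb14_slack_eq_cut' (h : IsCut ends c VA VB EA EB) {a₁ a₂ b o : V} (ha₁ : a₁ ∈ VA ∪ {c})
    (hb : b ∈ VA ∪ {c}) (ha₂ : a₂ ∈ VB ∪ {c}) (ho : o ∈ VB ∪ {c}) (F : Finset E) (z : Config E) :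
    pairCount F z (crossBO ends a₁ a₂ b o : Config E → Config E → R) -
        pairCount F z (sameBO ends a₁ a₂ b o) =
      (pairCount (sideFree EA F) (restrict EA z)
          (fun y w => iL ends a₁ b y * iL ends a₁ c w : Config E → Config E → R) -
        pairCount (sideFree EA F) (restrict EA z) (fun y _ => iL ends a₁ b y * iL ends a₁ c y)) *
      (pairCount (sideFree EB F) (restrict EB z)
          (fun y w => iH ends a₂ c y * iH ends a₂ o w : Config E → Config E → R) -
        pairCount (sideFree EB F) (restrict EB z) (fun y _ => iH ends a₂ c y * iH ends a₂ o y)) := by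
  -- the side invariances
  have hℓ : ∀ u : Config E, (iL ends a₁ b (restrict EA u) : R) = iL ends a₁ b u :=
    iL_restrict_EA h ha₁ hb
  have hs : ∀ u : Config E, (iL ends a₁ c (restrict EA u) : R) = iL ends a₁ c u :=
    iL_restrict_EA h ha₁ (Or.inr rfl)
  have hh : ∀ u : Config E, (iH ends a₂ o (restrict EB u) : R) = iH ends a₂ o u :=
    iH_restrict_EB h ha₂ ho
  have ht : ∀ u : Config E, (iH ends a₂ c (restrict EB u) : R) = iH ends a₂ c u :=
    iH_restrict_EB h ha₂ (Or.inr rfl)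
  -- the swap of the cross count
  rw [pairCount_swap F z (crossBO ends a₁ a₂ b o), ← pairCount_sub]
  -- the pointwise expansion of the difference through `iQ_eq_cut`
  have hpt : ∀ y w : Config E,
      crossBO ends a₁ a₂ b o w y - (sameBO ends a₁ a₂ b o y w : R) =
        iL ends a₁ b y * (iH ends a₂ o w - iH ends a₂ o y) -
          (iL ends a₁ b y * iL ends a₁ c y) * (iH ends a₂ c y * (iH ends a₂ o w - iH ends a₂ o y)) -
          (iL ends a₁ b y * iL ends a₁ c w) * (iH ends a₂ c w * (iH ends a₂ o w - iH ends a₂ o y)) +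
          (iL ends a₁ b y * (iL ends a₁ c y * iL ends a₁ c w)) *
            (iH ends a₂ c y * iH ends a₂ c w * (iH ends a₂ o w - iH ends a₂ o y)) := by
    intro y w
    simp only [crossBO, sameBO]
    rw [iQ_eq_cut' h ha₁ ha₂ y, iQ_eq_cut' h ha₁ ha₂ w]
    ring
  simp_rw [hpt]
  rw [pairCount_add, pairCount_sub, pairCount_sub]
  -- the four products factorise across the cut
  have e1 := pairCount_mul_of_cut h F z (fun y _ => (iL ends a₁ b y : R))
    (fun y w => iH ends a₂ o w - iH ends a₂ o y)
    (by intro y w; simp only [hℓ]) (by intro y w; simp only [hh])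
  have e2 := pairCount_mul_of_cut h F z (fun y _ => (iL ends a₁ b y * iL ends a₁ c y : R))
    (fun y w => iH ends a₂ c y * (iH ends a₂ o w - iH ends a₂ o y))
    (by intro y w; simp only [hℓ, hs]) (by intro y w; simp only [hh, ht])
  have e3 := pairCount_mul_of_cut h F z (fun y w => (iL ends a₁ b y * iL ends a₁ c w : R))
    (fun y w => iH ends a₂ c w * (iH ends a₂ o w - iH ends a₂ o y))
    (by intro y w; simp only [hℓ, hs]) (by intro y w; simp only [hh, ht])
  have e4 := pairCount_mul_of_cut h F z
    (fun y w => (iL ends a₁ b y * (iL ends a₁ c y * iL ends a₁ c w) : R))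
    (fun y w => iH ends a₂ c y * iH ends a₂ c w * (iH ends a₂ o w - iH ends a₂ o y))
    (by intro y w; simp only [hℓ, hs]) (by intro y w; simp only [hh, ht])
  rw [e1, e2, e3, e4]
  -- the `B`-side swap symmetries
  have hB1 : pairCount (sideFree EB F) (restrict EB z)
      (fun y w => iH ends a₂ o w - iH ends a₂ o y : Config E → Config E → R) = 0 := by
    rw [pairCount_sub, pairCount_swap (sideFree EB F) (restrict EB z) (fun y _ => iH ends a₂ o y),
      sub_self]
  have hB2 : pairCount (sideFree EB F) (restrict EB z)
      (fun y w => iH ends a₂ c y * (iH ends a₂ o w - iH ends a₂ o y) : Config E → Config E → R) =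
      pairCount (sideFree EB F) (restrict EB z)
          (fun y w => iH ends a₂ c y * iH ends a₂ o w : Config E → Config E → R) -
        pairCount (sideFree EB F) (restrict EB z) (fun y _ => iH ends a₂ c y * iH ends a₂ o y) := by
    rw [← pairCount_sub]
    congr 1
    funext y w
    ring
  have hB3 : pairCount (sideFree EB F) (restrict EB z)
      (fun y w => iH ends a₂ c w * (iH ends a₂ o w - iH ends a₂ o y) : Config E → Config E → R) =
      - pairCount (sideFree EB F) (restrict EB z)
        (fun y w => iH ends a₂ c y * (iH ends a₂ o w - iH ends a₂ o y)) := by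
    rw [pairCount_swap (sideFree EB F) (restrict EB z)
      (fun y w => iH ends a₂ c w * (iH ends a₂ o w - iH ends a₂ o y)), ← pairCount_neg']
    congr 1
    funext y w
    ring
  have hB4 : pairCount (sideFree EB F) (restrict EB z)
      (fun y w => iH ends a₂ c y * iH ends a₂ c w * (iH ends a₂ o w - iH ends a₂ o y) :
        Config E → Config E → R) = 0 := by
    have hsw := pairCount_swap (sideFree EB F) (restrict EB z)
      (fun y w => iH ends a₂ c y * iH ends a₂ c w * (iH ends a₂ o w - iH ends a₂ o y) :
        Config E → Config E → R)
    have hneg : pairCount (sideFree EB F) (restrict EB z)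
        (fun y w => iH ends a₂ c w * iH ends a₂ c y * (iH ends a₂ o y - iH ends a₂ o w) :
          Config E → Config E → R) =
        - pairCount (sideFree EB F) (restrict EB z)
          (fun y w => iH ends a₂ c y * iH ends a₂ c w * (iH ends a₂ o w - iH ends a₂ o y)) := by
      rw [← pairCount_neg']
      congr 1
      funext y w
      ring
    rw [hneg] at hsw
    linarith
  rw [hB1, hB3, hB4, hB2]
  ring

/-- **Typed BHK 1.4 across a cut vertex separating the marks** (THEOREM, unconditional): if an
unmarked cut vertex `c` separates `a₁, b` from `a₂, o`, then at every profile
`N(Q ∩ A ∩ B, Q) ≤ N(Q ∩ B, Q ∩ A)` — both factors of `tb14_slack_eq_cut` are `≤ 0` by typed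
Harris on one root. -/
theorem tb14_of_cut_opposite' (h : IsCut ends c VA VB EA EB) {a₁ a₂ b o : V} (ha₁ : a₁ ∈ VA ∪ {c})
    (hb : b ∈ VA ∪ {c}) (ha₂ : a₂ ∈ VB ∪ {c}) (ho : o ∈ VB ∪ {c}) (F : Finset E) (z : Config E) :
    pairCount F z (sameBO ends a₁ a₂ b o : Config E → Config E → R) ≤
      pairCount F z (crossBO ends a₁ a₂ b o) := by
  rw [← sub_nonneg, tb14_slack_eq_cut' h ha₁ hb ha₂ ho F z]
  have hA := PairHarris.pairCount_harris_iL (R := R) ends a₁ b c (sideFree EA F) (restrict EA z)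
  have hB := PairHarris.pairCount_harris_iH (R := R) ends a₂ c o (sideFree EB F) (restrict EB z)
  rw [← neg_mul_neg]
  exact mul_nonneg (neg_nonneg.2 (sub_nonpos.2 hA)) (neg_nonneg.2 (sub_nonpos.2 hB))

/-- **Both marks on the side of `a₂`**: typed BHK 1.4 on the instance follows from typed BHK 1.4
on the side `B` with roots `(c, a₂)`; the rest is p5's half-conditioned theorem on the side `B`
and two nonnegative `A`-side counts. -/
theorem tb14_of_cut_sideB' (h : IsCut ends c VA VB EA EB) {a₁ a₂ b o : V} (ha₁ : a₁ ∈ VA ∪ {c})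
    (ha₂ : a₂ ∈ VB ∪ {c}) (hb : b ∈ VB ∪ {c}) (ho : o ∈ VB ∪ {c}) (F : Finset E) (z : Config E)
    (hB : pairCount (sideFree EB F) (restrict EB z) (sameBO ends c a₂ b o : Config E → Config E → R) ≤
      pairCount (sideFree EB F) (restrict EB z) (crossBO ends c a₂ b o)) :
    pairCount F z (sameBO ends a₁ a₂ b o : Config E → Config E → R) ≤
      pairCount F z (crossBO ends a₁ a₂ b o) := by
  rw [← sub_nonneg, tb14_slack_eq]
  -- side invariances
  have hs : ∀ u : Config E, (iL ends a₁ c (restrict EA u) : R) = iL ends a₁ c u :=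
    iL_restrict_EA h ha₁ (Or.inr rfl)
  have hρ : ∀ u : Config E, (iL ends c b (restrict EB u) : R) = iL ends c b u := fun u =>
    iH_restrict_EB h (Or.inr rfl) hb u
  have hh : ∀ u : Config E, (iH ends a₂ o (restrict EB u) : R) = iH ends a₂ o u :=
    iH_restrict_EB h ha₂ ho
  have ht : ∀ u : Config E, (iH ends a₂ c (restrict EB u) : R) = iH ends a₂ c u :=
    iH_restrict_EB h ha₂ (Or.inr rfl)
  -- the pointwise expansion
  have hpt : ∀ y w : Config E,
      (iQ ends a₁ a₂ y : R) * iQ ends a₁ a₂ w * iL ends a₁ b y *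
          (iH ends a₂ o w - iH ends a₂ o y) =
        iL ends a₁ c y * ((1 - iH ends a₂ c y) * iL ends c b y *
            (iH ends a₂ o w - iH ends a₂ o y)) -
          (iL ends a₁ c y * iL ends a₁ c w) * ((1 - iH ends a₂ c y) * iH ends a₂ c w *
            iL ends c b y * (iH ends a₂ o w - iH ends a₂ o y)) := by
    intro y w
    rw [iQ_eq_cut' h ha₁ ha₂ y, iQ_eq_cut' h ha₁ ha₂ w, iL_cross' h ha₁ hb y]
    have hid := iL_mul_self (R := R) ends a₁ c y
    linear_combination (iL ends a₁ c w * iH ends a₂ c y * iH ends a₂ c w - iH ends a₂ c y) *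
      iL ends c b y * (iH ends a₂ o w - iH ends a₂ o y) * hid
  simp_rw [hpt]
  rw [pairCount_sub]
  have e1 := pairCount_mul_of_cut h F z (fun y _ => (iL ends a₁ c y : R))
    (fun y w => (1 - iH ends a₂ c y) * iL ends c b y * (iH ends a₂ o w - iH ends a₂ o y))
    (by intro y w; simp only [hs]) (by intro y w; simp only [hρ, hh, ht])
  have e2 := pairCount_mul_of_cut h F z (fun y w => (iL ends a₁ c y * iL ends a₁ c w : R))
    (fun y w => (1 - iH ends a₂ c y) * iH ends a₂ c w * iL ends c b y *
      (iH ends a₂ o w - iH ends a₂ o y))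
    (by intro y w; simp only [hs]) (by intro y w; simp only [hρ, hh, ht])
  rw [e1, e2]
  -- the half form on the side `B`, and the side-`B` slack
  set FB := sideFree EB F
  set zB := restrict EB z
  have hhalf : (0 : R) ≤ pairCount FB zB
      (fun y w => (1 - iH ends a₂ c y) * iL ends c b y * (iH ends a₂ o w - iH ends a₂ o y)) := by
    have h0 := TypedBHKHalf.pairCount_half (R := R) ends c a₂ b o FB zB
    rw [← sub_nonneg, ← pairCount_sub] at h0
    refine le_of_le_of_eq h0 ?_
    congr 1
    funext y w
    rw [iQ_eq_one_sub_iH]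
    ring
  have hslack : pairCount FB zB
      (fun y w => (1 - iH ends a₂ c y) * (1 - iH ends a₂ c w) * iL ends c b y *
        (iH ends a₂ o w - iH ends a₂ o y)) =
      pairCount FB zB (crossBO ends c a₂ b o : Config E → Config E → R) -
        pairCount FB zB (sameBO ends c a₂ b o) := by
    rw [tb14_slack_eq]
    congr 1
    funext y w
    rw [iQ_eq_one_sub_iH, iQ_eq_one_sub_iH]
  -- `X = HALF − D_B`
  have hX : pairCount FB zB
      (fun y w => (1 - iH ends a₂ c y) * iH ends a₂ c w * iL ends c b y *
        (iH ends a₂ o w - iH ends a₂ o y)) =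
      pairCount FB zB
        (fun y w => (1 - iH ends a₂ c y) * iL ends c b y * (iH ends a₂ o w - iH ends a₂ o y)) -
      (pairCount FB zB (crossBO ends c a₂ b o : Config E → Config E → R) -
        pairCount FB zB (sameBO ends c a₂ b o)) := by
    rw [← hslack, ← pairCount_sub]
    congr 1
    funext y w
    ring
  rw [hX]
  -- `D = N_A(c ∈ C∖C') · HALF + N_A(c ∈ C∩C') · D_B`
  have hsplit : pairCount (sideFree EA F) (restrict EA z) (fun y _ => (iL ends a₁ c y : R)) =
      pairCount (sideFree EA F) (restrict EA z)
          (fun y w => iL ends a₁ c y * (1 - iL ends a₁ c w)) +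
        pairCount (sideFree EA F) (restrict EA z) (fun y w => iL ends a₁ c y * iL ends a₁ c w) := by
    rw [← pairCount_add]
    congr 1
    funext y w
    ring
  rw [hsplit]
  have hD : (0 : R) ≤ pairCount FB zB (crossBO ends c a₂ b o : Config E → Config E → R) -
      pairCount FB zB (sameBO ends c a₂ b o) := sub_nonneg.2 hB
  have hn1 : (0 : R) ≤ pairCount (sideFree EA F) (restrict EA z)
      (fun y w => iL ends a₁ c y * (1 - iL ends a₁ c w)) :=
    pairCount_nonneg _ _ _ fun y w => mul_nonneg (iL_nonneg'' ends a₁ c y)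
      (sub_nonneg.2 (iL_le_one ends a₁ c w))
  have hn2 : (0 : R) ≤ pairCount (sideFree EA F) (restrict EA z)
      (fun y w => iL ends a₁ c y * iL ends a₁ c w) :=
    pairCount_nonneg _ _ _ fun y w => mul_nonneg (iL_nonneg'' ends a₁ c y) (iL_nonneg'' ends a₁ c w)
  nlinarith [mul_nonneg hn1 hhalf, mul_nonneg hn2 hD]

/-- **Both marks on the side of `a₁`**: the mirror image of `tb14_of_cut_sideB` under the
relabelling `(a₁, a₂, b, o) ↦ (a₂, a₁, o, b)`; typed BHK 1.4 on the instance follows from typed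
BHK 1.4 on the side `A` with roots `(a₁, c)`. -/
theorem tb14_of_cut_sideA' (h : IsCut ends c VA VB EA EB) {a₁ a₂ b o : V} (ha₁ : a₁ ∈ VA ∪ {c})
    (ha₂ : a₂ ∈ VB ∪ {c}) (hb : b ∈ VA ∪ {c}) (ho : o ∈ VA ∪ {c}) (F : Finset E) (z : Config E)
    (hA : pairCount (sideFree EA F) (restrict EA z) (sameBO ends a₁ c b o : Config E → Config E → R) ≤
      pairCount (sideFree EA F) (restrict EA z) (crossBO ends a₁ c b o)) :
    pairCount F z (sameBO ends a₁ a₂ b o : Config E → Config E → R) ≤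
      pairCount F z (crossBO ends a₁ a₂ b o) := by
  rw [← sub_nonneg, ← tb14_slack_relabel, sub_nonneg]
  refine tb14_of_cut_sideB' h.symm ha₂ ha₁ ho hb F z ?_
  rw [← sub_nonneg, tb14_slack_relabel, sub_nonneg]
  exact hA

/-- **The marks crossed** (`b` on the side of `a₂`, `o` on the side of `a₁`): the slack is a
single product of two nonnegative side counts, `N_A(c ∈ C(a₁) ∖ C'(a₁), o ∈ C'(c)) ·
N_B(c ∈ C'(a₂) ∖ C(a₂), b ∈ C(c))`, hence typed BHK 1.4 holds unconditionally. -/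
theorem tb14_of_cut_crossed' (h : IsCut ends c VA VB EA EB) {a₁ a₂ b o : V} (ha₁ : a₁ ∈ VA ∪ {c})
    (ha₂ : a₂ ∈ VB ∪ {c}) (hb : b ∈ VB ∪ {c}) (ho : o ∈ VA ∪ {c}) (F : Finset E) (z : Config E) :
    pairCount F z (sameBO ends a₁ a₂ b o : Config E → Config E → R) ≤
      pairCount F z (crossBO ends a₁ a₂ b o) := by
  rw [← sub_nonneg, tb14_slack_eq]
  have hs : ∀ u : Config E, (iL ends a₁ c (restrict EA u) : R) = iL ends a₁ c u :=
    iL_restrict_EA h ha₁ (Or.inr rfl)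
  have hκ : ∀ u : Config E, (iH ends c o (restrict EA u) : R) = iH ends c o u := fun u =>
    iL_restrict_EA h (Or.inr rfl) ho u
  have hρ : ∀ u : Config E, (iL ends c b (restrict EB u) : R) = iL ends c b u := fun u =>
    iH_restrict_EB h (Or.inr rfl) hb u
  have ht : ∀ u : Config E, (iH ends a₂ c (restrict EB u) : R) = iH ends a₂ c u :=
    iH_restrict_EB h ha₂ (Or.inr rfl)
  have hpt : ∀ y w : Config E,
      (iQ ends a₁ a₂ y : R) * iQ ends a₁ a₂ w * iL ends a₁ b y *
          (iH ends a₂ o w - iH ends a₂ o y) =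
        (iL ends a₁ c y * (1 - iL ends a₁ c w) * iH ends c o w) *
          ((1 - iH ends a₂ c y) * iH ends a₂ c w * iL ends c b y) := by
    intro y w
    rw [iQ_eq_cut' h ha₁ ha₂ y, iQ_eq_cut' h ha₁ ha₂ w, iL_cross' h ha₁ hb y, iH_cross' h ha₂ ho y,
      iH_cross' h ha₂ ho w]
    have hss := iL_mul_self (R := R) ends a₁ c y
    have htt : (iH ends a₂ c y : R) * iH ends a₂ c y = iH ends a₂ c y := iL_mul_self ends a₂ c y
    have htw : (iH ends a₂ c w : R) * iH ends a₂ c w = iH ends a₂ c w := iL_mul_self ends a₂ c w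
    linear_combination
      (-(iL ends a₁ c y * iL ends a₁ c w * iL ends c b y * iH ends c o w *
          (1 - iL ends a₁ c y * iH ends a₂ c y))) * htw +
      (-((1 - iL ends a₁ c w) * iH ends a₂ c w * iL ends c b y * iH ends c o w * iH ends a₂ c y) +
          iL ends c b y * iH ends c o y * (1 - iL ends a₁ c w * iH ends a₂ c w) *
            (iH ends a₂ c y * iH ends a₂ c y)) * hss +
      (iL ends c b y * iH ends c o y * (1 - iL ends a₁ c w * iH ends a₂ c w) * iL ends a₁ c y) * htt
  simp_rw [hpt]
  rw [pairCount_mul_of_cut h F z _ _ (fun y w => by simp only [hs, hκ])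
    (fun y w => by simp only [hρ, ht])]
  refine mul_nonneg (pairCount_nonneg _ _ _ fun y w => ?_) (pairCount_nonneg _ _ _ fun y w => ?_)
  · exact mul_nonneg (mul_nonneg (iL_nonneg'' ends a₁ c y) (sub_nonneg.2 (iL_le_one ends a₁ c w)))
      (iL_nonneg'' ends c o w)
  · exact mul_nonneg (mul_nonneg (sub_nonneg.2 (iL_le_one ends a₂ c y)) (iL_nonneg'' ends a₂ c w))
      (iL_nonneg'' ends c b y)

/-- **Typed BHK 1.4 across a root-separating cut vertex, all placements of the marks**: if an
unmarked cut vertex `c` separates `a₁` from `a₂`, typed BHK 1.4 at the profile `(F, z)` follows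
from typed BHK 1.4 on the side `A` with roots `(a₁, c)` and on the side `B` with roots `(c, a₂)`
(at the side profiles, with the same marks). -/
theorem tb14_of_cut' (h : IsCut ends c VA VB EA EB) {a₁ a₂ b o : V} (ha₁ : a₁ ∈ VA ∪ {c})
    (ha₂ : a₂ ∈ VB ∪ {c}) (hb : b ∈ VA ∪ {c} ∨ b ∈ VB ∪ {c}) (ho : o ∈ VA ∪ {c} ∨ o ∈ VB ∪ {c}) (F : Finset E) (z : Config E)
    (hA : pairCount (sideFree EA F) (restrict EA z) (sameBO ends a₁ c b o : Config E → Config E → R) ≤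
      pairCount (sideFree EA F) (restrict EA z) (crossBO ends a₁ c b o))
    (hB : pairCount (sideFree EB F) (restrict EB z) (sameBO ends c a₂ b o : Config E → Config E → R) ≤
      pairCount (sideFree EB F) (restrict EB z) (crossBO ends c a₂ b o)) :
    pairCount F z (sameBO ends a₁ a₂ b o : Config E → Config E → R) ≤
      pairCount F z (crossBO ends a₁ a₂ b o) := by
  rcases hb with hb | hb <;> rcases ho with ho | ho
  · exact tb14_of_cut_sideA' h ha₁ ha₂ hb ho F z hA
  · exact tb14_of_cut_opposite' h ha₁ hb ha₂ ho F z
  · exact tb14_of_cut_crossed' h ha₁ ha₂ hb ho F z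
  · exact tb14_of_cut_sideB' h ha₁ ha₂ hb ho F z hB

end Main

end TB14Cut

end Summit.Ventures.PercRepro2
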